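import Summits.QuantumFields.BalabanUV.T4Continuum.Support.T4TrajectoryDensityFresh

/-!
# `T4Continuum.T4TrajectoryDensityPerFamily` — the lattice pipeline with the STEP DATA INDEXED PER FAMILY (operation, integrand
# class, fluctuation domain, weight, exponent, measure per `(b, k)` = the met COMPONENT of family `b` at step `k`), answering the
# ideation seat's format finding N-glob/R3 (`t4/b2b-balaban-t4-ne1p-p2-g17/NE1p-OBSSUM-g17.md` §6): with ONE global exponent per
# step the slice binders `hE`/`hP` ask the oscillation of an EXTENSIVE quantity under a global window move and are unsuppliable;
# per component they are the printed-type local statements (cell `pub-balaban`, sub-cell `t4`, spine estimate NE1′ (node O3b/H2),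
# lineage t4-ne1p-p1 = PROVER seat P1 «RG-trajectory comparison», generation 22; tree target
# `Summits/QuantumFields/BalabanUV/T4Continuum/Support/`; ADDITIVE — imports `T4TrajectoryDensityFresh` ONLY; re-assembles the
# E-free induction `T4TrajectoryModulus.transportsFromVar_of_moduli_dep` with per-family step laws; modifies nothing)

HONEST FRAMING.  Finite four-torus, rung (B)+1 only — NOT infinite volume, NOT a mass gap, NOT the Clay problem, NOT summit
progress.  «continuum YM on T⁴ ⇐ BetaPertH ∧ nine spine estimates (0/9 proved); BetaPertH ⇐ (D1) ∧ (D4) ∧ CAP+tail; G-an2-4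
gates asym, D1 and NE2/3/4».  [folklore] kernel glue over the Literature leaves `T4TrajectoryModulus` / `T4TrajectoryDensity`
(every analytic lemma BY NAME: `transportsFromVar_of_moduli_dep`, `respMod_raw_of_birthSlice`, `contStepLawOn_of_opSlice_windowed`,
`supCost_of_opSliceOn`, `opSliceOn_centred`, `hdir_lattice`, `hcov_add`, `hpair_add`, `opSliceOn_wOp_dressed`), 0 sorry, 0
citations; nothing of Bałaban's densities or the cell's D-terms is asserted.

WHY THIS LEAF.  In `T4TrajectoryModulus.transportsFromVar_of_linearOpSlicesOn_lattice` (and hence in `T4TrajectoryDensity`'s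
v1.2.1 capstone, part 1's dressed capstone and §9's centred one) the step operation `E k`, its class `𝒢 k`, fluctuation domain
`D k` and — downstream — the weight's base/exponent/measure `base k`, `𝒜 k`, `𝒬 k`, `μ k` depend on the step `k` ONLY, while the
families `b` they transport are many.  Read literally for a step with several met components this makes `𝒜 k` the exponent of
the WHOLE step and `hE`'s oscillation bound `s k ≤ 1` a bound on an extensive quantity under a global chart move (the window norm
`latN` is a sup norm: a direction may be supported everywhere) — N-glob.  The mathematics is local: Bałaban's 𝐓′_k(X) operations
are normalised PER COMPONENT X with «all the expressions … localized in the domain X» ([Balaban1989LargeFieldII] p. 379, read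
this generation), and a product weight's other factors cancel in the normalised operation of a component.  The induction
underneath (`transportsFromVar_of_moduli_dep`: birth moduli + modulus-multiplicative continuation ⟹ `TransportsFromVar`) never
needed a common `E k`: its continuation binder is per `(b, k′, k)`.  So this leaf re-assembles the same chain with
`E b k`, `𝒢 b k`, `D b k`, `a b k` (and per-family diameters `θ b k`): `cont_of_contStepLawOn_fam`, `transportsFromVar_of_opSlices_fam`,
`transportsFromVar_of_linearOpSlicesOn_fam`, `transportsFromVar_of_linearOpSlicesOn_lattice_fam`, and the dressed-centred lattice
capstone `transportsFromVar_of_centredExponent_lattice_fam` with `base b k`, `𝒜 b k`, `𝒬 b k`, `q b k`, `μ b k`, `z₀ b k`,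
`ref b k`, `s b k`, `s₁ b k` — SAME conclusion `T.TransportsFromVar (4c_δ/r) (fun i => ψ·α i) Gate` with the uniform rate `α k`
dominating every family's step factor.  Every binder is the corresponding binder of the originals with the extra index; nothing
else changes.  The per-step instance (`E b k := E k`, …) recovers the originals.
-/

namespace Summit.QuantumFields.BalabanUV.T4Continuum.T4TrajectoryDensityDressed

open MeasureTheory Set Metric Filter
open Literature.MathematicalPhysics.QuantumFieldTheory.Balaban1983to89
open T4TermFormat T4TermFormat.Booking T4GatedBooking T4TrajectoryComparison T4TrajectoryModulus
open T4BirthChartTransport (GaugeInvariant BirthSlice RelGauge)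
open T4BlockTransport (Fld NDir latMove latN latMove_zero)
open T4TrajectoryDensity

noncomputable section

/-! ## §18 The E-free induction re-assembled with per-family step laws [folklore] -/

section PerFamilyAbstract

variable {B : Booking} {T : Trajectory B}
variable {𝒰 Dir F : Type*} [NormedAddCommGroup F] [NormedSpace ℂ F] [CompleteSpace F]

omit [NormedSpace ℂ F] [CompleteSpace F] in
/-- **THE CONTINUATION BINDER FROM PER-FAMILY STEP LAWS** — `T4TrajectoryModulus.cont_of_contStepLawOn_dep` VERBATIM with the
operation `E b k`, class `𝒢 b k`, composition `act b k`, domain `D b k` and sup cost `a b k` indexed by the family as well as the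
step; the uniform rate `α k` dominates `a b k + ℓ b k′ k·ω b k′ k` for every family.  Proof: pointwise, as the original. [folklore] -/
theorem cont_of_contStepLawOn_fam {Z : Type*} {Gate : ℕ → Prop} {Fn : B.Birth → ℕ → ℕ → 𝒰 → F}
    {Adm : B.Birth → ℕ → ℕ → 𝒰 → 𝒰 → ℝ → Prop} {𝒢 : B.Birth → ℕ → Set (Z → F)}
    {E : B.Birth → ℕ → 𝒰 → (Z → F) → F} {act : B.Birth → ℕ → Z → 𝒰 → 𝒰} {D : B.Birth → ℕ → Set Z}
    {a : B.Birth → ℕ → ℝ} {α : ℕ → ℝ} {ℓ ω : B.Birth → ℕ → ℕ → ℝ} {w : ℝ}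
    (hAdm : ∀ b k' k U₀ U₁ δ, Adm b k' k U₀ U₁ δ → 0 ≤ δ)
    (hFn : ∀ (b : B.Birth) (k' k : ℕ), B.birthScale b ≤ k' → k' ≤ k → k + 1 ≤ B.K → RanBelow Gate (k + 1) →
      ∀ U, Fn b k' (k + 1) U = E b k U (fun z => Fn b k' k (act b k z U)))
    (h𝒢 : ∀ (b : B.Birth) (k' k : ℕ), B.birthScale b ≤ k' → k' ≤ k → k + 1 ≤ B.K → RanBelow Gate (k + 1) →
      ∀ U, (fun z => Fn b k' k (act b k z U)) ∈ 𝒢 b k)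
    (hlaw : ∀ (b : B.Birth) (k' k : ℕ), B.birthScale b ≤ k' → k' ≤ k → k + 1 ≤ B.K → RanBelow Gate (k + 1) →
      ContStepLawOn (𝒢 b k) (E b k) (act b k) (D b k) (Adm b k' (k + 1)) (Adm b k' k) w (a b k) (ℓ b k' k) (ω b k' k))
    (hdom : ∀ (b : B.Birth) (k' k : ℕ), B.birthScale b ≤ k' → k' ≤ k → k + 1 ≤ B.K →
      a b k + ℓ b k' k * ω b k' k ≤ α k) :
    ∀ (b : B.Birth) (k' k : ℕ), B.birthScale b ≤ k' → k' ≤ k → k + 1 ≤ B.K → RanBelow Gate (k + 1) →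
      ∀ M : ℝ, 0 ≤ M → RespMod (Fn b k' k) (Adm b k' k) w M →
        RespMod (Fn b k' (k + 1)) (Adm b k' (k + 1)) w (α k * M) := by
  intro b k' k hbk' hk'k hk hran M hM hG
  have h := ((hlaw b k' k hbk' hk'k hk hran).respMod_continue (h𝒢 b k' k hbk' hk'k hk hran) hM hG).congr_fun
    (hFn b k' k hbk' hk'k hk hran)
  exact h.mono (hAdm b k' (k + 1)) (mul_le_mul_of_nonneg_right (hdom b k' k hbk' hk'k hk) hM)

variable {move : 𝒰 → Dir → ℂ → 𝒰} {w r : ℝ}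

/-- **THE WINDOW-GUARDED PIPELINE FROM OPERATOR SLICES, PER FAMILY** — `T4TrajectoryModulus.transportsFromVar_of_opSlices_windowed`
VERBATIM with `𝒢 b k`, `E b k`, `act b k`, `D b k`, `a b k`; SAME conclusion.  Proof: the original's, over the E-free
`transportsFromVar_of_moduli_dep`. [folklore] -/
theorem transportsFromVar_of_opSlices_fam {Z : Type*} {Gate : ℕ → Prop} {Fn : B.Birth → ℕ → ℕ → 𝒰 → F}
    {rel : B.Birth → ℕ → ℕ → 𝒰 → 𝒰 → Prop} {Nk : B.Birth → ℕ → ℕ → Dir → ℝ} {𝒦 : B.Birth → ℕ → ℕ → Set 𝒰}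
    {𝒢 : B.Birth → ℕ → Set (Z → F)} {E : B.Birth → ℕ → 𝒰 → (Z → F) → F} {act : B.Birth → ℕ → Z → 𝒰 → 𝒰}
    {D : B.Birth → ℕ → Set Z} {defect : B.Birth → ℕ → ℕ → ℝ} {cδ ψ : ℝ} {a : B.Birth → ℕ → ℝ} {α : ℕ → ℝ}
    {ϱ ω : B.Birth → ℕ → ℕ → ℝ}
    (hα : ∀ i, 0 ≤ α i) (hr : 0 < r) (hmove : ∀ U d, move U d 0 = U)
    (hsl : ∀ (b : B.Birth) (k' : ℕ), B.birthScale b ≤ k' → k' ≤ B.K → RanBelow Gate k' →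
      BirthSlice (Fn b k' k') move (Nk b k' k') (𝒦 b k' k') w r (T.gen b k'))
    (hFn : ∀ (b : B.Birth) (k' k : ℕ), B.birthScale b ≤ k' → k' ≤ k → k + 1 ≤ B.K → RanBelow Gate (k + 1) →
      ∀ U, Fn b k' (k + 1) U = E b k U (fun z => Fn b k' k (act b k z U)))
    (h𝒢 : ∀ (b : B.Birth) (k' k : ℕ), B.birthScale b ≤ k' → k' ≤ k → k + 1 ≤ B.K → RanBelow Gate (k + 1) →
      ∀ U, (fun z => Fn b k' k (act b k z U)) ∈ 𝒢 b k)
    (hD : ∀ b k, (D b k).Nonempty) (hϱ : ∀ b k' k, 0 < ϱ b k' k)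
    (hsup : ∀ (b : B.Birth) (k' k : ℕ), B.birthScale b ≤ k' → k' ≤ k → k + 1 ≤ B.K → RanBelow Gate (k + 1) →
      ∀ U₀ ∈ 𝒦 b k' (k + 1), ∀ g ∈ 𝒢 b k, ∀ g' ∈ 𝒢 b k, ∀ (m : ℝ), (∀ z ∈ D b k, ‖g z - g' z‖ ≤ m) →
        ‖E b k U₀ g - E b k U₀ g'‖ ≤ a b k * m)
    (hEsl : ∀ (b : B.Birth) (k' k : ℕ), B.birthScale b ≤ k' → k' ≤ k → k + 1 ≤ B.K → RanBelow Gate (k + 1) →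
      ∀ g ∈ 𝒢 b k, ∀ (c : F) (m : ℝ), (∀ z ∈ D b k, ‖g z - c‖ ≤ m) →
        BirthSlice (fun U => E b k U g - c) move (Nk b k' (k + 1)) (𝒦 b k' (k + 1)) w (ϱ b k' k) (a b k * m))
    (hcov : ∀ (b : B.Birth) (k' k : ℕ), B.birthScale b ≤ k' → k' ≤ k → k + 1 ≤ B.K → RanBelow Gate (k + 1) →
      ∀ (U₀ U₁ : 𝒰) (δ : ℝ), RawAdm move (Nk b k' (k + 1)) (𝒦 b k' (k + 1)) U₀ U₁ δ → δ ≤ w → ∀ z ∈ D b k,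
        RawAdm move (Nk b k' k) (𝒦 b k' k) (act b k z U₀) (act b k z U₁) δ)
    (hpair : ∀ (b : B.Birth) (k' k : ℕ), B.birthScale b ≤ k' → k' ≤ k → k + 1 ≤ B.K → RanBelow Gate (k + 1) →
      ∀ (U₀ U₁ : 𝒰) (δ : ℝ), RawAdm move (Nk b k' (k + 1)) (𝒦 b k' (k + 1)) U₀ U₁ δ → δ ≤ w →
        ∀ z ∈ D b k, ∀ z' ∈ D b k, z ≠ z' →
          RawAdm move (Nk b k' k) (𝒦 b k' k) (act b k z' U₁) (act b k z U₁) (ω b k' k))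
    (hω : ∀ b k' k, 0 ≤ ω b k' k ∧ ω b k' k ≤ w)
    (hdom : ∀ (b : B.Birth) (k' k : ℕ), B.birthScale b ≤ k' → k' ≤ k → k + 1 ≤ B.K →
      a b k * (1 + 4 * ω b k' k / ϱ b k' k) ≤ α k)
    (hinv : ∀ b k' k, GaugeInvariant (rel b k' k) (Fn b k' k))
    (hdefw : ∀ b k' k, defect b k' k ≤ w)
    (hrate : ∀ (b : B.Birth) (k' k : ℕ), B.birthScale b ≤ k' → k' ≤ k → k ≤ B.K →
      defect b k' k ≤ cδ * ψ ^ (k - k'))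
    (hlin : ∀ (b : B.Birth) (k' k : ℕ), B.birthScale b ≤ k' → k' ≤ k → k ≤ B.K → RanBelow Gate k → ∀ ε > 0,
      ∃ U₀ ∈ 𝒦 b k' k, ∃ U₁ : 𝒰, RelGauge (rel b k' k) move (Nk b k' k) U₀ U₁ (defect b k' k) ∧
        T.lin b k' k ≤ ‖Fn b k' k U₁ - Fn b k' k U₀‖ + ε) :
    T.TransportsFromVar (4 * cδ / r) (fun i => ψ * α i) Gate := by
  have h := transportsFromVar_of_moduli_dep (T := T) (C₀ := 4 / r)
    (Adm := fun b k' k => Windowed (RawAdm move (Nk b k' k) (𝒦 b k' k)) w) (by positivity) hα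
    (fun b k' hbk' hk hran =>
      ((respMod_raw_of_birthSlice (hsl b k' hbk' hk hran) hmove hr (T.gen_nonneg b k')).congr_const
        (by ring)).of_imp fun _ _ _ hadm => hadm.1)
    (cont_of_contStepLawOn_fam (Adm := fun b k' k => Windowed (RawAdm move (Nk b k' k) (𝒦 b k' k)) w) (𝒢 := 𝒢)
      (D := D) (ℓ := fun b k' k => 4 * a b k / ϱ b k' k) (ω := ω)
      (fun b k' k U₀ U₁ δ hadm => rawAdm_nonneg hadm.1) hFn h𝒢
      (fun b k' k hbk' hk'k hk hran => contStepLawOn_of_opSlice_windowed (hD b k) (hϱ b k' k) hmove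
        (hsup b k' k hbk' hk'k hk hran) (hEsl b k' k hbk' hk'k hk hran)
        (fun U₀ U₁ δ hadm hδ z hz => ⟨hcov b k' k hbk' hk'k hk hran U₀ U₁ δ hadm hδ z hz, hδ⟩)
        (fun U₀ U₁ δ hadm hδ z hz z' hz' hzz =>
          ⟨hpair b k' k hbk' hk'k hk hran U₀ U₁ δ hadm hδ z hz z' hz' hzz, (hω b k' k).2⟩)
        (hω b k' k).1 (hω b k' k).2)
      (fun b k' k hbk' hk'k hk => by
        show a b k + 4 * a b k / ϱ b k' k * ω b k' k ≤ α k
        rw [stepFactor_eq]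
        exact hdom b k' k hbk' hk'k hk))
    hdefw hrate
    (fun b k' k hbk' hk'k hk hran ε hε => by
      obtain ⟨U₀, hU₀, U₁, ⟨dd, hd, hdδ, hrel⟩, hle⟩ := hlin b k' k hbk' hk'k hk hran ε hε
      refine ⟨U₀, move U₀ dd 1, ⟨⟨hU₀, dd, hd, hdδ, rfl⟩, hdefw b k' k⟩, ?_⟩
      rwa [hinv b k' k _ _ hrel] at hle)
  have e : 4 / r * cδ = 4 * cδ / r := by ring
  rw [e] at h
  exact h

/-- **THE CLASS-GUARDED LINEAR-OPERATION PIPELINE, PER FAMILY** —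
`T4TrajectoryModulus.transportsFromVar_of_linearOpSlicesOn_windowed` VERBATIM with `𝒢 b k`, `E b k`, `act b k`, `D b k`, `a b k`
(subtractivity `hsub`, normalisation `hnorm` and the operator slice `hop` of each family's own step operation). [folklore] -/
theorem transportsFromVar_of_linearOpSlicesOn_fam {Z : Type*} {Gate : ℕ → Prop} {Fn : B.Birth → ℕ → ℕ → 𝒰 → F}
    {rel : B.Birth → ℕ → ℕ → 𝒰 → 𝒰 → Prop} {Nk : B.Birth → ℕ → ℕ → Dir → ℝ} {𝒦 : B.Birth → ℕ → ℕ → Set 𝒰}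
    {𝒢 : B.Birth → ℕ → Set (Z → F)} {E : B.Birth → ℕ → 𝒰 → (Z → F) → F} {act : B.Birth → ℕ → Z → 𝒰 → 𝒰}
    {D : B.Birth → ℕ → Set Z} {defect : B.Birth → ℕ → ℕ → ℝ} {cδ ψ : ℝ} {a : B.Birth → ℕ → ℝ} {α : ℕ → ℝ}
    {ϱ ω : B.Birth → ℕ → ℕ → ℝ}
    (hα : ∀ i, 0 ≤ α i) (hr : 0 < r) (hmove : ∀ U d, move U d 0 = U)
    (hsl : ∀ (b : B.Birth) (k' : ℕ), B.birthScale b ≤ k' → k' ≤ B.K → RanBelow Gate k' →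
      BirthSlice (Fn b k' k') move (Nk b k' k') (𝒦 b k' k') w r (T.gen b k'))
    (hFn : ∀ (b : B.Birth) (k' k : ℕ), B.birthScale b ≤ k' → k' ≤ k → k + 1 ≤ B.K → RanBelow Gate (k + 1) →
      ∀ U, Fn b k' (k + 1) U = E b k U (fun z => Fn b k' k (act b k z U)))
    (h𝒢 : ∀ (b : B.Birth) (k' k : ℕ), B.birthScale b ≤ k' → k' ≤ k → k + 1 ≤ B.K → RanBelow Gate (k + 1) →
      ∀ U, (fun z => Fn b k' k (act b k z U)) ∈ 𝒢 b k)
    (hD : ∀ b k, (D b k).Nonempty) (hϱ : ∀ b k' k, 0 < ϱ b k' k)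
    (h𝒢c : ∀ (b : B.Birth) (k : ℕ) (c : F), (fun _ : Z => c) ∈ 𝒢 b k)
    (h𝒢s : ∀ (b : B.Birth) (k : ℕ), ∀ g ∈ 𝒢 b k, ∀ g' ∈ 𝒢 b k, g - g' ∈ 𝒢 b k)
    (hsub : ∀ (b : B.Birth) (k : ℕ) (U : 𝒰), ∀ g ∈ 𝒢 b k, ∀ g' ∈ 𝒢 b k, E b k U (g - g') = E b k U g - E b k U g')
    (hnorm : ∀ (b : B.Birth) (k : ℕ) (U : 𝒰) (c : F), E b k U (fun _ => c) = c)
    (hop : ∀ (b : B.Birth) (k' k : ℕ), B.birthScale b ≤ k' → k' ≤ k → k + 1 ≤ B.K → RanBelow Gate (k + 1) →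
      OpSliceOn (𝒢 b k) (E b k) (D b k) move (Nk b k' (k + 1)) (𝒦 b k' (k + 1)) w (ϱ b k' k) (a b k))
    (hdir : ∀ (b : B.Birth) (k' k : ℕ), B.birthScale b ≤ k' → k' ≤ k → k + 1 ≤ B.K →
      ∃ d : Dir, 0 < Nk b k' (k + 1) d ∧ Nk b k' (k + 1) d ≤ w)
    (hcov : ∀ (b : B.Birth) (k' k : ℕ), B.birthScale b ≤ k' → k' ≤ k → k + 1 ≤ B.K → RanBelow Gate (k + 1) →
      ∀ (U₀ U₁ : 𝒰) (δ : ℝ), RawAdm move (Nk b k' (k + 1)) (𝒦 b k' (k + 1)) U₀ U₁ δ → δ ≤ w → ∀ z ∈ D b k,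
        RawAdm move (Nk b k' k) (𝒦 b k' k) (act b k z U₀) (act b k z U₁) δ)
    (hpair : ∀ (b : B.Birth) (k' k : ℕ), B.birthScale b ≤ k' → k' ≤ k → k + 1 ≤ B.K → RanBelow Gate (k + 1) →
      ∀ (U₀ U₁ : 𝒰) (δ : ℝ), RawAdm move (Nk b k' (k + 1)) (𝒦 b k' (k + 1)) U₀ U₁ δ → δ ≤ w →
        ∀ z ∈ D b k, ∀ z' ∈ D b k, z ≠ z' →
          RawAdm move (Nk b k' k) (𝒦 b k' k) (act b k z' U₁) (act b k z U₁) (ω b k' k))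
    (hω : ∀ b k' k, 0 ≤ ω b k' k ∧ ω b k' k ≤ w)
    (hdom : ∀ (b : B.Birth) (k' k : ℕ), B.birthScale b ≤ k' → k' ≤ k → k + 1 ≤ B.K →
      a b k * (1 + 4 * ω b k' k / ϱ b k' k) ≤ α k)
    (hinv : ∀ b k' k, GaugeInvariant (rel b k' k) (Fn b k' k))
    (hdefw : ∀ b k' k, defect b k' k ≤ w)
    (hrate : ∀ (b : B.Birth) (k' k : ℕ), B.birthScale b ≤ k' → k' ≤ k → k ≤ B.K →
      defect b k' k ≤ cδ * ψ ^ (k - k'))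
    (hlin : ∀ (b : B.Birth) (k' k : ℕ), B.birthScale b ≤ k' → k' ≤ k → k ≤ B.K → RanBelow Gate k → ∀ ε > 0,
      ∃ U₀ ∈ 𝒦 b k' k, ∃ U₁ : 𝒰, RelGauge (rel b k' k) move (Nk b k' k) U₀ U₁ (defect b k' k) ∧
        T.lin b k' k ≤ ‖Fn b k' k U₁ - Fn b k' k U₀‖ + ε) :
    T.TransportsFromVar (4 * cδ / r) (fun i => ψ * α i) Gate :=
  transportsFromVar_of_opSlices_fam hα hr hmove hsl hFn h𝒢 hD hϱ
    (fun b k' k hbk' hk'k hk hran =>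
      supCost_of_opSliceOn (h𝒢s b k) (hsub b k) (hop b k' k hbk' hk'k hk hran) hmove (hϱ b k' k).le
        (hdir b k' k hbk' hk'k hk))
    (fun b k' k hbk' hk'k hk hran =>
      opSliceOn_centred (h𝒢c b k) (h𝒢s b k) (hsub b k) (hnorm b k) (hop b k' k hbk' hk'k hk hran))
    hcov hpair hω hdom hinv hdefw hrate hlin

end PerFamilyAbstract

/-! ## §19 On `ℤ^d`, per family; the dressed-centred capstone per family [folklore] -/

section PerFamilyLattice

variable {B : Booking} {T : Trajectory B}
variable {R : Type*} [NormedRing R] [NormedAlgebra ℂ R] {d : ℕ}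
  {F : Type*} [NormedAddCommGroup F] [NormedSpace ℂ F] [CompleteSpace F]

/-- **ON `ℤ^d`, PER FAMILY** — `T4TrajectoryModulus.transportsFromVar_of_linearOpSlicesOn_lattice` VERBATIM with `𝒢 b k`,
`E b k`, `D b k`, `a b k`, `θ b k` (composition = addition of the fluctuation; the chart geometry `hdir_lattice`, `hcov_add`,
`hpair_add` by name). [folklore] -/
theorem transportsFromVar_of_linearOpSlicesOn_lattice_fam {Gate : ℕ → Prop} {Fn : B.Birth → ℕ → ℕ → Fld d R → F}
    {rel : B.Birth → ℕ → ℕ → Fld d R → Fld d R → Prop} {𝒦 : B.Birth → ℕ → ℕ → Set (Fld d R)}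
    {𝒢 : B.Birth → ℕ → Set (Fld d R → F)} {E : B.Birth → ℕ → Fld d R → (Fld d R → F) → F}
    {D : B.Birth → ℕ → Set (Fld d R)} {defect : B.Birth → ℕ → ℕ → ℝ} {cδ ψ w r : ℝ}
    {a θ : B.Birth → ℕ → ℝ} {α : ℕ → ℝ} {ϱ : B.Birth → ℕ → ℕ → ℝ}
    (hα : ∀ i, 0 ≤ α i) (hr : 0 < r) (hw : 0 < w)
    (hsl : ∀ (b : B.Birth) (k' : ℕ), B.birthScale b ≤ k' → k' ≤ B.K → RanBelow Gate k' →
      BirthSlice (Fn b k' k') latMove latN (𝒦 b k' k') w r (T.gen b k'))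
    (hFn : ∀ (b : B.Birth) (k' k : ℕ), B.birthScale b ≤ k' → k' ≤ k → k + 1 ≤ B.K → RanBelow Gate (k + 1) →
      ∀ U, Fn b k' (k + 1) U = E b k U (fun z => Fn b k' k (U + z)))
    (h𝒢 : ∀ (b : B.Birth) (k' k : ℕ), B.birthScale b ≤ k' → k' ≤ k → k + 1 ≤ B.K → RanBelow Gate (k + 1) →
      ∀ U, (fun z => Fn b k' k (U + z)) ∈ 𝒢 b k)
    (hD : ∀ b k, (D b k).Nonempty) (hϱ : ∀ b k' k, 0 < ϱ b k' k)
    (h𝒢c : ∀ (b : B.Birth) (k : ℕ) (c : F), (fun _ : Fld d R => c) ∈ 𝒢 b k)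
    (h𝒢s : ∀ (b : B.Birth) (k : ℕ), ∀ g ∈ 𝒢 b k, ∀ g' ∈ 𝒢 b k, g - g' ∈ 𝒢 b k)
    (hsub : ∀ (b : B.Birth) (k : ℕ) (U : Fld d R), ∀ g ∈ 𝒢 b k, ∀ g' ∈ 𝒢 b k,
      E b k U (g - g') = E b k U g - E b k U g')
    (hnorm : ∀ (b : B.Birth) (k : ℕ) (U : Fld d R) (c : F), E b k U (fun _ => c) = c)
    (hop : ∀ (b : B.Birth) (k' k : ℕ), B.birthScale b ≤ k' → k' ≤ k → k + 1 ≤ B.K → RanBelow Gate (k + 1) →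
      OpSliceOn (𝒢 b k) (E b k) (D b k) latMove latN (𝒦 b k' (k + 1)) w (ϱ b k' k) (a b k))
    (hN1 : ∀ (b : B.Birth) (k' k : ℕ), B.birthScale b ≤ k' → k' ≤ k → k + 1 ≤ B.K →
      ∀ z ∈ D b k, ∀ U ∈ 𝒦 b k' (k + 1), U + z ∈ 𝒦 b k' k)
    (hN2 : ∀ (b : B.Birth) (k' k : ℕ), B.birthScale b ≤ k' → k' ≤ k → k + 1 ≤ B.K →
      ∀ U₀ ∈ 𝒦 b k' (k + 1), ∀ p : NDir d R, latN p ≤ w → ∀ z' ∈ D b k, latMove U₀ p 1 + z' ∈ 𝒦 b k' k)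
    (hdiam : ∀ b k, ∀ z ∈ D b k, ∀ z' ∈ D b k, ∀ x ν, ‖z x ν - z' x ν‖ ≤ θ b k)
    (hθ : ∀ b k, 0 < θ b k ∧ θ b k ≤ w)
    (hdom : ∀ (b : B.Birth) (k' k : ℕ), B.birthScale b ≤ k' → k' ≤ k → k + 1 ≤ B.K →
      a b k * (1 + 4 * θ b k / ϱ b k' k) ≤ α k)
    (hinv : ∀ b k' k, GaugeInvariant (rel b k' k) (Fn b k' k))
    (hdefw : ∀ b k' k, defect b k' k ≤ w)
    (hrate : ∀ (b : B.Birth) (k' k : ℕ), B.birthScale b ≤ k' → k' ≤ k → k ≤ B.K →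
      defect b k' k ≤ cδ * ψ ^ (k - k'))
    (hlin : ∀ (b : B.Birth) (k' k : ℕ), B.birthScale b ≤ k' → k' ≤ k → k ≤ B.K → RanBelow Gate k → ∀ ε > 0,
      ∃ U₀ ∈ 𝒦 b k' k, ∃ U₁ : Fld d R, RelGauge (rel b k' k) latMove latN U₀ U₁ (defect b k' k) ∧
        T.lin b k' k ≤ ‖Fn b k' k U₁ - Fn b k' k U₀‖ + ε) :
    T.TransportsFromVar (4 * cδ / r) (fun i => ψ * α i) Gate :=
  transportsFromVar_of_linearOpSlicesOn_fam (act := fun _ _ z U => U + z) (Nk := fun _ _ _ => latN)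
    (ϱ := ϱ) (ω := fun b _ k => θ b k) hα hr latMove_zero hsl hFn h𝒢 hD hϱ h𝒢c h𝒢s hsub hnorm hop
    (fun _ _ _ _ _ _ => hdir_lattice hw)
    (fun b k' k hbk' hk'k hk _ U₀ U₁ δ hadm _ z hz => hcov_add (hN1 b k' k hbk' hk'k hk) U₀ U₁ δ hadm z hz)
    (fun b k' k hbk' hk'k hk _ => hpair_add (hθ b k).1 (hdiam b k) (hN2 b k' k hbk' hk'k hk))
    (fun b _ k => ⟨(hθ b k).1.le, (hθ b k).2⟩) hdom hinv hdefw hrate hlin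

variable [MeasurableSpace R]

/-- **THE DRESSED PIPELINE WITH A CENTRED PERTURBATION SLICE, PER FAMILY** — §9's `transportsFromVar_of_centredExponent_lattice`
VERBATIM with the weight data of the met COMPONENT of family `b` at step `k`: base `base b k`, action exponent `𝒜 b k` about the
reference `ref b k` with oscillation `s b k`, observable-attached exponent `𝒬 b k` with free fluctuation-constant part `q b k` and
centred oscillation `s₁ b k`, fluctuation measure `μ b k` with rest point `z₀ b k` and domain `D b k` of diameter `θ b k`; per-step
budget `s b k + s₁ b k ≤ 1` and domination `e^{3(s b k + s₁ b k)}·(1 + 4θ b k/ϱ b k′ k) ≤ α k` for every family; SAME conclusion.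
THIS is the faithfully-indexed home of the binders `hB`/`hE`/`hP`: local statements about one component's weight (printed TYPE
(1.71)–(1.75), component-localized), not about the whole step. [folklore] -/
theorem transportsFromVar_of_centredExponent_lattice_fam {Gate : ℕ → Prop} {Fn : B.Birth → ℕ → ℕ → Fld d R → F}
    {rel : B.Birth → ℕ → ℕ → Fld d R → Fld d R → Prop} {𝒦 : B.Birth → ℕ → ℕ → Set (Fld d R)}
    {ref : B.Birth → ℕ → Fld d R → Fld d R} {base : B.Birth → ℕ → Fld d R → ℝ}
    {𝒜 𝒬 : B.Birth → ℕ → Fld d R → Fld d R → ℂ} {q : B.Birth → ℕ → Fld d R → ℂ}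
    {μ : B.Birth → ℕ → Measure (Fld d R)} {z₀ : B.Birth → ℕ → Fld d R} {D : B.Birth → ℕ → Set (Fld d R)}
    {defect : B.Birth → ℕ → ℕ → ℝ} {cδ ψ w r : ℝ} {s s₁ θ : B.Birth → ℕ → ℝ} {α : ℕ → ℝ}
    {ϱ : B.Birth → ℕ → ℕ → ℝ}
    (hα : ∀ i, 0 ≤ α i) (hr : 0 < r) (hw : 0 < w)
    (hsl : ∀ (b : B.Birth) (k' : ℕ), B.birthScale b ≤ k' → k' ≤ B.K → RanBelow Gate k' →
      BirthSlice (Fn b k' k') latMove latN (𝒦 b k' k') w r (T.gen b k'))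
    (hFn : ∀ (b : B.Birth) (k' k : ℕ), B.birthScale b ≤ k' → k' ≤ k → k + 1 ≤ B.K → RanBelow Gate (k + 1) →
      ∀ U, Fn b k' (k + 1) U =
        wOp (expWeight (base b k) (𝒜 b k + 𝒬 b k)) (μ b k) (z₀ b k) U (fun z => Fn b k' k (U + z)))
    (h𝒢 : ∀ (b : B.Birth) (k' k : ℕ), B.birthScale b ≤ k' → k' ≤ k → k + 1 ≤ B.K → RanBelow Gate (k + 1) →
      ∀ U, (fun z => Fn b k' k (U + z)) ∈ BddClass F (μ b k))
    (hD : ∀ b k, (D b k).Nonempty) (hϱ : ∀ b k' k, 0 < ϱ b k' k)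
    (hB : ∀ (b : B.Birth) (k' k : ℕ), B.birthScale b ≤ k' → k' ≤ k → k + 1 ≤ B.K → RanBelow Gate (k + 1) →
      RealBaseAt (ref b k) (base b k) (𝒜 b k) (μ b k) (𝒦 b k' (k + 1)))
    (hE : ∀ (b : B.Birth) (k' k : ℕ), B.birthScale b ≤ k' → k' ≤ k → k + 1 ≤ B.K → RanBelow Gate (k + 1) →
      ExponentSliceAt (ref b k) (𝒜 b k) (μ b k) latMove latN (𝒦 b k' (k + 1)) w (ϱ b k' k) (s b k))
    (hP : ∀ (b : B.Birth) (k' k : ℕ), B.birthScale b ≤ k' → k' ≤ k → k + 1 ≤ B.K → RanBelow Gate (k + 1) →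
      PertSlice (fun U z => 𝒬 b k U z - q b k U) (μ b k) latMove latN (𝒦 b k' (k + 1)) w (ϱ b k' k) (s₁ b k))
    (hs : ∀ b k, s b k + s₁ b k ≤ 1) (hDμ : ∀ b k, ∀ᵐ z ∂μ b k, z ∈ D b k)
    (hN1 : ∀ (b : B.Birth) (k' k : ℕ), B.birthScale b ≤ k' → k' ≤ k → k + 1 ≤ B.K →
      ∀ z ∈ D b k, ∀ U ∈ 𝒦 b k' (k + 1), U + z ∈ 𝒦 b k' k)
    (hN2 : ∀ (b : B.Birth) (k' k : ℕ), B.birthScale b ≤ k' → k' ≤ k → k + 1 ≤ B.K →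
      ∀ U₀ ∈ 𝒦 b k' (k + 1), ∀ p : NDir d R, latN p ≤ w → ∀ z' ∈ D b k, latMove U₀ p 1 + z' ∈ 𝒦 b k' k)
    (hdiam : ∀ b k, ∀ z ∈ D b k, ∀ z' ∈ D b k, ∀ x ν, ‖z x ν - z' x ν‖ ≤ θ b k)
    (hθ : ∀ b k, 0 < θ b k ∧ θ b k ≤ w)
    (hdom : ∀ (b : B.Birth) (k' k : ℕ), B.birthScale b ≤ k' → k' ≤ k → k + 1 ≤ B.K →
      Real.exp (3 * (s b k + s₁ b k)) * (1 + 4 * θ b k / ϱ b k' k) ≤ α k)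
    (hinv : ∀ b k' k, GaugeInvariant (rel b k' k) (Fn b k' k))
    (hdefw : ∀ b k' k, defect b k' k ≤ w)
    (hrate : ∀ (b : B.Birth) (k' k : ℕ), B.birthScale b ≤ k' → k' ≤ k → k ≤ B.K →
      defect b k' k ≤ cδ * ψ ^ (k - k'))
    (hlin : ∀ (b : B.Birth) (k' k : ℕ), B.birthScale b ≤ k' → k' ≤ k → k ≤ B.K → RanBelow Gate k → ∀ ε > 0,
      ∃ U₀ ∈ 𝒦 b k' k, ∃ U₁ : Fld d R, RelGauge (rel b k' k) latMove latN U₀ U₁ (defect b k' k) ∧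
        T.lin b k' k ≤ ‖Fn b k' k U₁ - Fn b k' k U₀‖ + ε) :
    T.TransportsFromVar (4 * cδ / r) (fun i => ψ * α i) Gate := by
  -- exact recentring (§9): the step law with the CENTRED exponent
  have e : ∀ b k, 𝒜 b k + 𝒬 b k = (𝒜 b k + fun U z => 𝒬 b k U z - q b k U) + fun U _ => q b k U := fun b k => by
    funext U z
    simp only [Pi.add_apply]
    ring
  have hFn' : ∀ (b : B.Birth) (k' k : ℕ), B.birthScale b ≤ k' → k' ≤ k → k + 1 ≤ B.K → RanBelow Gate (k + 1) →
      ∀ U, Fn b k' (k + 1) U =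
        wOp (expWeight (base b k) (𝒜 b k + fun U z => 𝒬 b k U z - q b k U)) (μ b k) (z₀ b k) U
          (fun z => Fn b k' k (U + z)) := by
    intro b k' k h₁ h₂ h₃ h₄ U
    rw [hFn b k' k h₁ h₂ h₃ h₄ U, e b k, wOp_expWeight_add_zconst]
  exact transportsFromVar_of_linearOpSlicesOn_lattice_fam (𝒢 := fun b k => BddClass F (μ b k))
    (E := fun b k => wOp (expWeight (base b k) (𝒜 b k + fun U z => 𝒬 b k U z - q b k U)) (μ b k) (z₀ b k))
    (a := fun b k => Real.exp (3 * (s b k + s₁ b k))) (ϱ := ϱ) (θ := θ)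
    hα hr hw hsl hFn' h𝒢 hD hϱ (fun b k c => const_mem_bddClass (μ b k) c)
    (fun b k _ hg _ hg' => sub_mem_bddClass hg hg')
    (fun b k U _ hg _ hg' => wOp_sub _ (μ b k) (z₀ b k) U hg hg')
    (fun b k U c => wOp_const _ (μ b k) (z₀ b k) U c)
    (fun b k' k hbk' hk'k hk hran =>
      opSliceOn_wOp_dressed (z₀ b k) (hB b k' k hbk' hk'k hk hran) (hE b k' k hbk' hk'k hk hran)
        (hP b k' k hbk' hk'k hk hran) (hs b k) (hDμ b k))
    hN1 hN2 hdiam hθ hdom hinv hdefw hrate hlin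

end PerFamilyLattice

end

end Summit.QuantumFields.BalabanUV.T4Continuum.T4TrajectoryDensityDressed
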